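import Summits.QuantumFields.BalabanUV.T4Continuum.Support.ShellMeasureLandauEndRayStokesAssembled
import Summits.QuantumFields.BalabanUV.T4Continuum.Support.ShellMeasureLandauWilsonSquaresKernelsSchwarzField
import Summits.QuantumFields.BalabanUV.T4Continuum.Support.ShellMeasureRayTermsPinnedLandauW

/-!
# `T4Continuum.ShellMeasureLandauEndRayStokesAssembledDecayV6` — row S112 f3 = THE v6 ROOT (owner R-ne7cp1-g37-1 (c2)): S80 f3
# `ShellMeasureLandauEndRayStokesAssembledDecay.slotAC_realized_su2_landauChart_assembled_decay` (leaf-09-g12) RE-ROOTED with BOTH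
# slots re-sourced — the Wilson slot by S112 f2 (the two pinned budgets in PRINT's field-size shape) and the non-Wilson (T3) slot by
# S113 f2 (leaf-01-g11: the 𝓔-leg's scheme tuple READ OFF the w-tuple's displayed kernels in S69's pinned dress — ONE exponent field)
(cell `pub-balaban`, sub-cell `t4`, spine estimate NE7c (node U5b); NE7c ROUND-2 crew, unit `b2b-balaban-t4-ne7c-formalise-leaf-07`
gen 10; owner table row **S112 f3** (RULINGS R-ne7cp1-g36-14 (a)(ii), R-ne7cp1-g37-1 (c2)); generated from the tree bytes of S80 f3 by
`gen_f3.py` (the two budgets, S112) then `gen_f3b.py` (the (T3) block, S113 — leaf-01-g11's call shape l.23083 verbatim) in the lineage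
folder, crediting S80 f3's author leaf-09-g12 and its pattern-givers leaf-04-g6∕g7; ADDITIVE — imports S80 `ShellMeasureLandauEndRayStokesAssembled`,
S112 f2 `ShellMeasureLandauWilsonSquaresKernelsSchwarzField`, S113 f2 `ShellMeasureRayTermsPinnedLandauW` ONLY; [folklore]; 0 `def`,
0 `def … : Prop`, 0 sorry, 0 citation tags; chain suffix `V6`∕`_v6` for leaf-03-g9's middle)

HONEST FRAMING.  Finite four-torus programme, rung (B)+1 only — NOT infinite volume, NOT a mass gap, NOT the Clay problem, NOT summit
progress; (B), `BetaPertHyp`, (B^μ) not consumed.  NE7c (`T4IndicatorShell.ShellWeightBound`) is NOT PRINTED in [Balaban 1983–89] and NOT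
PROVED; «NE7c ⇐ the named binders» (trigger c3): every binder below is DISPLAYED, asserted by nobody; CONDITIONAL on all of them; NOT
Bałaban's minimiser (node O).  HONEST DEPENDENCY (cell): continuum YM on T⁴ ⇐ BetaPertH ∧ nine spine estimates (0/9 proved); BetaPertH
⇐ (D1) ∧ (D4) ∧ CAP+tail; G-an2-4 gates asym, D1 and NE2/3/4.

THE TWO CHANGES vs S80 f3 (and nothing else).  (1) S112 (F-ne7cleaf06g9-1): the (T2) budgets read
`hqW : c𝒢·M𝒢·(4·C₄w·(ε₄w + B₀w·bw)·e^{δw·rW}) < 1`, `hk : 12·C₂w·(ε₄w + B₀w·bw)·e^{δw·rC}·(cι·Mι)·(cH·MH) < 1` (Cauchy at the FIELD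
radii, [Balaban1985Variational] (158) ∕ (53)–(54)'s shape — LOCATORS) with the matching two `z_pin` factors in the slot constant; the
Wilson supplier is S112 f2 `…_of_decay_field`.  (2) S113 (O-ne7cleaf01g11-1 ACCEPTED R-g37-1 (c1): «ONE term of (2.18) has ONE exponent
field», WALL R19): the (T3) e-TUPLE — carriers `Λe 𝔄 𝒴e′ 𝒳e 𝒵e ℬe`, pins `δ′ ϖ hδ′ hϖ`, letters `𝒢e W𝒱e H₁e Φe ιe He` with
`h𝒢e hWe hB₀e hC₄e hbe hH₁e hΦde hΦ0e hΦbe hSre hιe hHe` and the letters `B₀e C₄e a₃e be rΦe` — LEAVES the signature; the non-Wilson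
slot is supplied by S113 f2 `hE_landau_chartRay_pinned_w` at `𝒴 := WSup (pinW δw (ϖw∘pos)) 1 𝔄w`, `𝒢 := kerOpPin (k𝒢 V) …`,
`W𝒱 := toPiLz.symm ∘ W𝒱w V ∘ toPiL`, `H₁ := kerOpPin (kH₁ V) …`, `Φ := toPiLb.symm ∘ Φw V`, `ι := kerOpPin (kι V) …`, `H := kerOpPin (kH V) …`,
`B₀ C₄ a₃ b rΦ δ′ ϖ := B₀w (C₄w·e^{δw rW}) a₃w bw rΦw δw (ϖw∘pos)`.  STAY (re-lettered to the w-data): the e-leg's own numbers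
`ε₄e hε₄e hdome hselfe hcontre hqe hRCe hcoupE`, its Landau-correction pair `Ce hC₂e hCqe hCde` (now between the pinned spaces
`WSup (pinW δw (ϖw∘pos′)) 1 𝔄′ → WSup (pinW δw (ϖw∘posx)) 1 𝔅`), the TERM rows `I Ef rE ee hrE hEd hEb he0 supp hblind ϖP hdepth LK hLK hK`
(on `Λw → 𝔄w`, depth against `ϖw∘pos`, rate `δw`), `hElb₁` (its body at the new instances; derived higher up at S108 f3′ via
`hElb_landau_chartRay_pinned_w`), (S78) `μ g hg A Bd hBd0 hint hpos hA hElb₂`.  ENTER: `hϖ0 : ∀ x, 0 ≤ ϖw x` [sign], the three Schur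
number junctions `hB𝒢w hBH₁w hBHw : c·M· ≤ B₀w` [N] (S108's rows, born here at the root), `hιew : ∀ V Y, ‖kerOpPin (kι V) δw … Y‖ ≤ ‖Y‖`
[T, 1:1 for `hιe`].  The w-tuple's sup-norm rows `h𝒢w hHw hH₁w` STAY (S108 f2′ removes them in the middle).  CONCLUSION = S80 f3's with
the slot constant's Wilson factors as in (1) and the non-Wilson summand `3·(LK·(2z̄))∕(rΦw∕S − 1) + Bd`,
`z̄ = (ε₄e + B₀w·bw) + B₀w·(4C₂e(ε₄e + B₀w·bw)²)`.  Every Bałaban-type CONTENT row (propagator∕(P4)∕linear maps, the decay kernels, the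
sectioned non-Wilson terms, the dressed integral, the located background regularity rows of the Cf-links above) is untouched.
NOTHING in the countdown moves; NE7c NOT PROVED; spine PROVED 0∕9.
-/



noncomputable section

open Set Metric NormedSpace MeasureTheory Function

namespace Summit.QuantumFields.BalabanUV.T4Continuum.ShellMeasureLandauEndRayStokesAssembledDecayV6

open scoped ENNReal
open Literature.MathematicalPhysics.QuantumFieldTheory.Balaban1983to89
open B11Prop6Scheme (Prop4Hyp)
open GaugeField (GaugeInvariant)
open T4ShellMeasure (SlotAntiConcentration)
open T4CubePoincare (cube)
open T4CubeChartGnomonic (SU2)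
open T4CubeChartExp (expFibreChart)
open T4TreeGaugeFixing (NoClosedLoop fixTo)
open T4ShellMeasurePlaquette (expTail₂)
open ShellMeasureLevelAssembly (classifier)
open ShellMeasureMultiGridNorms (WSup)
open ShellMeasurePinnedNorm (pinW kerOpPin)
open ShellMeasureMultiGridNorms.WSup (toPiL)
open ShellMeasureLandauHolonomy (solAt landauExp)
open ShellMeasureLandauHolonomyChart (holOf cplx)
open ShellMeasureLandauHolonomySkew (readOutReal)
open ShellMeasureRayTermsPinnedLandauW (hE_landau_chartRay_pinned_w)
open ShellMeasureRayLogIntegral (rayBound_of_logIntegral rayBound_add)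
open ShellMeasureLandauEndFinal (slotAC_realized_su2_landauChart_final)
open ShellMeasureLandauEndRayStokesAssembled (wilsonProfile_nonneg)
open ShellMeasureDecayKernelSums (kerOp)
open ShellMeasureLandauWilsonSquaresKernelsSchwarzField (hE_landau_wilsonSquares_located_schwarz_of_decay_field)

/-! ## END-II-final ASSEMBLED at the reading of record: Wilson slot located, two radii, decay kernels displayed -/

section Assembled

open scoped Matrix.Norms.L2Operator

variable {P : Params} {j : ℕ} [DecidableEq (PBond P j)]
variable {n : Type*} [Fintype n] [DecidableEq n] [Nonempty n]
variable {𝒴 𝒴' 𝒳 𝒵 ℬ : Type*} [NormedAddCommGroup 𝒴] [NormedSpace ℂ 𝒴] [CompleteSpace 𝒴]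
  [NormedAddCommGroup 𝒴'] [NormedSpace ℂ 𝒴'] [NormedAddCommGroup 𝒳] [NormedSpace ℂ 𝒳] [CompleteSpace 𝒳]
  [NormedAddCommGroup 𝒵] [NormedSpace ℂ 𝒵] [NormedAddCommGroup ℬ] [NormedSpace ℂ ℬ]

/-- **END-II-FINAL, ASSEMBLED AT THE READING OF RECORD — WILSON SLOT LOCATED, AT TWO RADII, NOTHING PINNED DISPLAYED**
(row S85 f2 file 5; supersedes this row's file 3 `…_assembled_schwarz` and S80 `…_assembled` as the most-assembled declaration per
R-ne7cp1-g32-4).  S76 f2 `ShellMeasureLandauEndFinal.slotAC_realized_su2_landauChart_final` with BOTH 𝓔-slots DISCHARGED by the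
suppliers of record, per exterior section `V`: the Wilson slot by file 4
`ShellMeasureLandauWilsonSquaresKernelsSchwarz.hE_landau_wilsonSquares_located_schwarz_of_decay` over (T2) AT THE READING OF
RECORD (five flat pi-type chain spaces; the four linear letters as V-indexed DECAY KERNELS `k𝒢 kι kH kH₁` with V-uniform
constants `c·e^{−δ·dis}` and reduced-rate row sums `≤ M·`; the flat lists with Sect. C at radius `RCw`, `6(ε₄w + B₀w bw) ≤ RCw`;
localities `NW`∕`NC` with reaches; block support of `Φw V`; `2S ≤ r_Φ,w`; read-outs blind off `suppw p` at depth `ϖPw p`, flat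
op-norms `κ̄_w`, curl op-norm `κ̄_c`; unitary `B_p` with `‖B_p − 1‖ ≤ d_p ≤ d̄`; located count `Σ_p e^{−δw ϖPw p} ≤ K_w`), its
nonnegativity `hWlb` by S80 `wilsonProfile_nonneg` BY NAME, the non-Wilson slot by S71 f2 `hE_landau_chartRay_pinned` over (T3)
⊕ S78 `rayBound_of_logIntegral` through `rayBound_add` EXACTLY as S80.  CONCLUSION: (M1) per slot at the classifier threshold
`εθ·η²` with the slot constant `2(m₀ + (B_W⁽²⁾ + (3·LK·2z̄_e∕(r_Φ,e∕S − 1) + B_d)))∕(1 − δ)`,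
`B_W⁽²⁾ = 3·|β|·((d̄ + 2S̄∕(r_Φ,w∕S))·(2S̄∕(r_Φ,w∕S)))·K_w` written out (`S̄ = κ̄_c z_pin + expTail₂(m_w κ̄_w z_pin)`,
`z_pin = (c_{H₁}M_{H₁})b_w∕((1 − c_𝒢M_𝒢·2C₄a₃e^{δw r_W})(1 − 2C₂R_C e^{δw r_C}(c_ιM_ι)(c_HM_H)))`).  Every hypothesis is a
scheme∕read-out∕real-structure datum of one of the three displayed tuples, a decay kernel with its row sum, a locality, a located
budget (`K_w`, `LK`, `B_d`), a lower bound, a co-test∕window datum or a number; CONDITIONAL on all of them; nothing PRINTED is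
asserted; NOT Bałaban's minimiser; (M1) realized ≠ NE7c. [folklore] -/
theorem slotAC_realized_su2_landauChart_assembled_decay_v6 {T : Finset (PBond P j)} (hT : NoClosedLoop T)
    (U₀ : GaugeField P j SU2) (Λ : Finset (PBond P j)) {m₀ : ℕ} (e : ↥Λ × Fin 3 ≃ Fin m₀)
    {S : ℝ} (hS : 0 < S) (hSπ : 3 * S ^ 2 < Real.pi ^ 2) (c : GaugeField P j SU2 → GaugeField P j SU2)
    {F : GaugeField P j SU2 → ℝ≥0∞} (hF : Measurable F) (hFi : GaugeInvariant F)
    (hFsupp : ∀ V y, F (fixTo T U₀ (updateFinset V Λ y)) ≠ 0 →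
      ∀ b (hb : b ∈ Λ), dist1 ((c V b)⁻¹ * y ⟨b, hb⟩) ≤ 2 * Real.sin (S / 2))
    {u : GaugeField P j SU2 → ℝ} (hu : Measurable u) (hui : GaugeInvariant u)
    {ι : Type*} {Pu : Finset ι} (hPu : Pu.Nonempty)
    (W : GaugeField P j SU2 → Set (Fin m₀ → ℝ)) (Jco : GaugeField P j SU2 → (Fin m₀ → ℝ) → ℝ≥0∞)
    {δ ρ β : ℝ}
    (𝒢 : GaugeField P j SU2 → (𝒵 →L[ℂ] 𝒴)) (W𝒱 : GaugeField P j SU2 → 𝒴 → 𝒵) {B₀ C₄ a₃ ε₄ : ℝ}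
    (h𝒢 : ∀ V f, ‖𝒢 V f‖ ≤ B₀ * ‖f‖) (hW : ∀ V, Prop4Hyp (W𝒱 V) C₄ a₃) (hB₀ : 0 < B₀) (hC₄ : 0 ≤ C₄)
    (hε₄ : 0 ≤ ε₄)
    {dL C₁ B₃ ε₁ : ℝ} (hdL : 0 ≤ dL) (hC₁ : 0 ≤ C₁) (hε₁ : 0 ≤ ε₁) (hB₃ : dL ≤ B₃)
    (h1 : 2 * B₀ * C₁ * B₃ * ε₁ ≤ ε₄) (h2 : 4 * ε₄ ≤ a₃) (h3 : 16 * B₀ * C₄ * ε₄ ≤ 1)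
    (H₁ : GaugeField P j SU2 → (ℬ →L[ℂ] 𝒴)) (hH₁ : ∀ V B, ‖H₁ V B‖ ≤ B₀ * ‖B‖)
    (Φ : GaugeField P j SU2 → (Fin m₀ → ℂ) → ℬ) {rΦ : ℝ} (hΦd : ∀ V, DifferentiableOn ℂ (Φ V) (ball 0 rΦ))
    (hΦ0 : ∀ V, Φ V 0 = 0) (hΦ : ∀ V, ∀ z ∈ ball (0 : Fin m₀ → ℂ) rΦ, ‖Φ V z‖ < 2 * dL * C₁ * ε₁) (hSr : S < rΦ)
    (Cf : GaugeField P j SU2 → 𝒴' → 𝒳) {C₂ RC : ℝ} (hC₂ : 0 ≤ C₂)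
    (hCq : ∀ V, ∀ Z : 𝒴', ‖Z‖ < RC → ‖Cf V Z‖ ≤ C₂ * ‖Z‖ ^ 2) (hCd : ∀ V, DifferentiableOn ℂ (Cf V) (ball 0 RC))
    (ιs : GaugeField P j SU2 → (𝒴 →L[ℂ] 𝒴')) (hι : ∀ V Y, ‖ιs V Y‖ ≤ ‖Y‖)
    (Hop : GaugeField P j SU2 → (𝒳 →L[ℂ] 𝒴)) (hH : ∀ V X, ‖Hop V X‖ ≤ B₀ * ‖X‖)
    {ε₃ : ℝ} (h18 : 18 * C₂ * B₀ * ε₃ ≤ 1) (hcoup : ε₄ + B₀ * (2 * dL * C₁ * ε₁) ≤ ε₃) (h3R : 3 * ε₃ ≤ RC)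
    (ℓs : ι → List (𝒴 →L[ℂ] Matrix n n ℂ)) {κr : ℝ} (hκ : 0 ≤ κr)
    (hℓ : ∀ p ∈ Pu, ∀ ℓ ∈ ℓs p, ∀ Y, ‖ℓ Y‖ ≤ κr * ‖Y‖) {m : ℕ} (hlen : ∀ p ∈ Pu, (ℓs p).length ≤ m)
    {κc : ℝ} (hκc : 0 ≤ κc) (hcurl : ∀ p ∈ Pu, ∀ Y, ‖((ℓs p).map fun ℓ => ℓ Y).sum‖ ≤ κc * ‖Y‖)
    -- ══ (T2) THE WILSON SLOT'S SUPPLIER DATA AT THE READING OF RECORD (file 4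
    -- `ShellMeasureLandauWilsonSquaresKernelsSchwarz.hE_landau_wilsonSquares_located_schwarz_of_decay`, per exterior section `V`,
    -- V-uniform constants): five FLAT pi-type chain spaces, ONE pin profile on a common position space (one-sided Lipschitz),
    -- the four linear letters as V-indexed DECAY KERNELS with reduced-rate row sums ((3.133)∕Thm 3.3, (46), (103) decay-halves
    -- TYPE — LOCATORS), the flat printed-TYPE lists, two localities with reaches, the block support of the coarse field, blind
    -- flat read-outs, the located count — NOTHING PINNED DISPLAYED; the Wilson budget LOCATED and SECOND ORDER (γ6) ══
    {Λw Λz Λw' Λx Λb 𝔖 : Type*} [Fintype Λw] [DecidableEq Λw] [Fintype Λz] [Fintype Λw'] [Fintype Λx] [Fintype Λb]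
    {𝔄w ℭ 𝔄' 𝔅 𝔇 : Type*} [NormedAddCommGroup 𝔄w] [NormedSpace ℂ 𝔄w] [CompleteSpace 𝔄w]
    [NormedAddCommGroup ℭ] [NormedSpace ℂ ℭ] [NormedAddCommGroup 𝔄'] [NormedSpace ℂ 𝔄']
    [NormedAddCommGroup 𝔅] [NormedSpace ℂ 𝔅] [CompleteSpace 𝔅] [NormedAddCommGroup 𝔇] [NormedSpace ℂ 𝔇]
    {δw : ℝ} (hδw : 0 ≤ δw) (ϖw : 𝔖 → ℝ) (dis : 𝔖 → 𝔖 → ℝ) (hϖw : ∀ x y, ϖw x ≤ ϖw y + dis x y)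
    (pos : Λw → 𝔖) (posz : Λz → 𝔖) (pos' : Λw' → 𝔖) (posx : Λx → 𝔖) (posb : Λb → 𝔖)
    (k𝒢 : GaugeField P j SU2 → Λw → Λz → (ℭ →L[ℂ] 𝔄w)) (kι : GaugeField P j SU2 → Λw' → Λw → (𝔄w →L[ℂ] 𝔄'))
    (kH : GaugeField P j SU2 → Λw → Λx → (𝔅 →L[ℂ] 𝔄w)) (kH₁ : GaugeField P j SU2 → Λw → Λb → (𝔇 →L[ℂ] 𝔄w))
    {c𝒢 δ𝒢 M𝒢 cι δι Mι cH δH MH cH₁ δH₁ MH₁ : ℝ}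
    (hc𝒢 : 0 ≤ c𝒢) (hM𝒢 : 0 ≤ M𝒢) (hk𝒢 : ∀ V c b', ‖k𝒢 V c b'‖ ≤ c𝒢 * Real.exp (-(δ𝒢 * dis (pos c) (posz b'))))
    (hM𝒢' : ∀ x, ∑ b', Real.exp (-((δ𝒢 - δw) * dis x (posz b'))) ≤ M𝒢)
    (hcι : 0 ≤ cι) (hMι : 0 ≤ Mι) (hkι : ∀ V c b', ‖kι V c b'‖ ≤ cι * Real.exp (-(δι * dis (pos' c) (pos b'))))
    (hMι' : ∀ x, ∑ b', Real.exp (-((δι - δw) * dis x (pos b'))) ≤ Mι)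
    (hcH : 0 ≤ cH) (hMH : 0 ≤ MH) (hkH : ∀ V c b', ‖kH V c b'‖ ≤ cH * Real.exp (-(δH * dis (pos c) (posx b'))))
    (hMH' : ∀ x, ∑ b', Real.exp (-((δH - δw) * dis x (posx b'))) ≤ MH)
    (hcH₁ : 0 ≤ cH₁) (hMH₁ : 0 ≤ MH₁) (hkH₁ : ∀ V c b', ‖kH₁ V c b'‖ ≤ cH₁ * Real.exp (-(δH₁ * dis (pos c) (posb b'))))
    (hMH₁' : ∀ x, ∑ b', Real.exp (-((δH₁ - δw) * dis x (posb b'))) ≤ MH₁)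
    -- the flat lists (P2)∕(P4)∕(118)∕(121)∕(103)∕(75)-TYPE∕(44) at radius `RCw` with `6(ε₄w + B₀w·bw) ≤ RCw`∕scaling∕(46)∕(54)
    (W𝒱w : GaugeField P j SU2 → (Λw → 𝔄w) → (Λz → ℭ)) {B₀w C₄w a₃w ε₄w bw : ℝ}
    (h𝒢w : ∀ V f, ‖kerOp (k𝒢 V) f‖ ≤ B₀w * ‖f‖) (hWw : ∀ V, Prop4Hyp (W𝒱w V) C₄w a₃w) (hB₀w : 0 < B₀w) (hC₄w : 0 ≤ C₄w)
    (hε₄w : 0 ≤ ε₄w) (hdomw : 2 * (ε₄w + B₀w * bw) ≤ a₃w) (hselfw : B₀w * C₄w * (ε₄w + B₀w * bw) ^ 2 ≤ ε₄w)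
    (hcontrw : 4 * B₀w * C₄w * (ε₄w + B₀w * bw) < 1) (hH₁w : ∀ V B, ‖kerOp (kH₁ V) B‖ ≤ B₀w * ‖B‖)
    (Φw : GaugeField P j SU2 → (Fin m₀ → ℂ) → (Λb → 𝔇)) {rΦw : ℝ} (hΦdw : ∀ V, DifferentiableOn ℂ (Φw V) (ball 0 rΦw))
    (hΦ0w : ∀ V, Φw V 0 = 0) (hΦbw : ∀ V, ∀ z ∈ ball (0 : Fin m₀ → ℂ) rΦw, ‖Φw V z‖ < bw) (h2Sw : 2 * S ≤ rΦw)
    (Cw : GaugeField P j SU2 → (Λw' → 𝔄') → (Λx → 𝔅)) {C₂w RCw : ℝ} (hC₂w : 0 ≤ C₂w)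
    (hCqw : ∀ V, ∀ Z : Λw' → 𝔄', ‖Z‖ < RCw → ‖Cw V Z‖ ≤ C₂w * ‖Z‖ ^ 2) (hCdw : ∀ V, DifferentiableOn ℂ (Cw V) (ball 0 RCw))
    (hιw : ∀ V Y, ‖kerOp (kι V) Y‖ ≤ ‖Y‖) (hHw : ∀ V X, ‖kerOp (kH V) X‖ ≤ B₀w * ‖X‖)
    (hqw : 9 * C₂w * B₀w * (ε₄w + B₀w * bw) < 1) (hRCw : 6 * (ε₄w + B₀w * bw) ≤ RCw)
    -- localities with reaches, the block support, the two contraction numbers (DISPLAYED arithmetic on the decay constants)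
    (NW : Λz → Λw → Prop)
    (hlocW : ∀ V, ∀ A A' : Λw → 𝔄w, ∀ c', (∀ b', NW c' b' → A b' = A' b') → W𝒱w V A c' = W𝒱w V A' c')
    {rW : ℝ} (hreachW : ∀ c' b', NW c' b' → ϖw (posz c') - rW ≤ ϖw (pos b'))
    (NC : Λx → Λw' → Prop)
    (hlocC : ∀ V, ∀ A A' : Λw' → 𝔄', ∀ c', (∀ b', NC c' b' → A b' = A' b') → Cw V A c' = Cw V A' c')
    {rC : ℝ} (hreachC : ∀ c' b', NC c' b' → ϖw (posx c') - rC ≤ ϖw (pos' b'))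
    (hsupp : ∀ V, ∀ z : Fin m₀ → ℂ, ∀ i, 0 < ϖw (posb i) → Φw V z i = 0)
    (hqW : c𝒢 * M𝒢 * (4 * C₄w * (ε₄w + B₀w * bw) * Real.exp (δw * rW)) < 1)
    (hk : 12 * C₂w * (ε₄w + B₀w * bw) * Real.exp (δw * rC) * (cι * Mι) * (cH * MH) < 1)
    -- weight plaquettes; read-outs BLIND off located supports, FLAT op-norms, curl op-norm (DISPLAYED; `κ_c ∝ η²`), lengths
    {𝔭 : Type*} (Pw : Finset 𝔭) (ℓw : 𝔭 → List ((Λw → 𝔄w) →L[ℂ] Matrix n n ℂ)) (suppw : 𝔭 → Finset Λw)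
    (ϖPw : 𝔭 → ℝ)
    (hblindw : ∀ p ∈ Pw, ∀ ℓ ∈ ℓw p, ∀ A A' : Λw → 𝔄w, (∀ b' ∈ suppw p, A b' = A' b') → ℓ A = ℓ A')
    (hdepthw : ∀ p ∈ Pw, ∀ b' ∈ suppw p, ϖPw p ≤ ϖw (pos b')) (hϖPw : ∀ p ∈ Pw, 0 ≤ ϖPw p)
    {κwb κcb : ℝ} (hκwb : 0 ≤ κwb) (hκcb : 0 ≤ κcb) (hℓwb : ∀ p ∈ Pw, ∀ ℓ ∈ ℓw p, ‖ℓ‖ ≤ κwb)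
    (hcurlw : ∀ p ∈ Pw, ‖(ℓw p).sum‖ ≤ κcb)
    {mw : ℕ} (hlenw : ∀ p ∈ Pw, (ℓw p).length ≤ mw)
    -- the global tuple's real structure with SKEW weight read-outs
    (𝓡𝒴w : AddSubgroup (Λw → 𝔄w)) (h𝓡𝒴w : IsClosed (𝓡𝒴w : Set (Λw → 𝔄w))) (𝓡𝒵w : AddSubgroup (Λz → ℭ))
    (𝓡𝒴w' : AddSubgroup (Λw' → 𝔄')) (𝓡𝒳w : AddSubgroup (Λx → 𝔅)) (h𝓡𝒳w : IsClosed (𝓡𝒳w : Set (Λx → 𝔅)))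
    (𝓡ℬw : AddSubgroup (Λb → 𝔇))
    (h𝒢rw : ∀ V, ∀ f ∈ 𝓡𝒵w, kerOp (k𝒢 V) f ∈ 𝓡𝒴w) (hWrw : ∀ V, ∀ Y ∈ 𝓡𝒴w, W𝒱w V Y ∈ 𝓡𝒵w)
    (hιrw : ∀ V, ∀ Y ∈ 𝓡𝒴w, kerOp (kι V) Y ∈ 𝓡𝒴w') (hHrw : ∀ V, ∀ X ∈ 𝓡𝒳w, kerOp (kH V) X ∈ 𝓡𝒴w)
    (hCrw : ∀ V, ∀ Z ∈ 𝓡𝒴w', Cw V Z ∈ 𝓡𝒳w) (hH₁rw : ∀ V, ∀ B ∈ 𝓡ℬw, kerOp (kH₁ V) B ∈ 𝓡𝒴w)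
    (hΦrw : ∀ V, ∀ y : Fin m₀ → ℝ, ‖y‖ ≤ S → Φw V (cplx y) ∈ 𝓡ℬw)
    (hskew : ∀ p ∈ Pw, ∀ ℓ ∈ ℓw p, ∀ Y ∈ 𝓡𝒴w, ℓ Y ∈ skewAdjoint (Matrix n n ℂ))
    -- the frozen background plaquettes (N-ne7cp1-g31-2) with a uniform size bound, the located count, `0 ≤ β`
    (Bp : GaugeField P j SU2 → 𝔭 → Matrix n n ℂ) {d : 𝔭 → ℝ} {dbar : ℝ}
    (hBu : ∀ V, ∀ p ∈ Pw, Bp V p ∈ unitary (Matrix n n ℂ)) (hBd : ∀ V, ∀ p ∈ Pw, ‖Bp V p - 1‖ ≤ d p)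
    (hd : ∀ p ∈ Pw, d p ≤ dbar) (hdbar : 0 ≤ dbar)
    {Kw : ℝ} (hKw : ∑ p ∈ Pw, Real.exp (-(δw * ϖPw p)) ≤ Kw)
    -- ══ (T3) THE LOCATED NON-WILSON TERMS — THE 𝓔-LEG READ OFF THE w-TUPLE's KERNELS IN THE PINNED DRESS (S113, leaf-01-g11:
    -- `hE_landau_chartRay_pinned_w`): ONE exponent field; the e-tuple's carriers and letters are GONE; ENTERING the pin sign, the three
    -- Schur number junctions (S108's rows, born here) and the pinned restriction row; the e-leg's own numbers, its Landau-correction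
    -- pair (between the pinned spaces), the TERM rows and the coupling STAY ══
    (hϖ0 : ∀ x, 0 ≤ ϖw x) (hB𝒢w : c𝒢 * M𝒢 ≤ B₀w) (hBH₁w : cH₁ * MH₁ ≤ B₀w) (hBHw : cH * MH ≤ B₀w)
    {ε₄e : ℝ} (hε₄e : 0 ≤ ε₄e) (hdome : 2 * (ε₄e + B₀w * bw) ≤ a₃w)
    (hselfe : B₀w * (C₄w * Real.exp (δw * rW)) * (ε₄e + B₀w * bw) ^ 2 ≤ ε₄e)
    (hcontre : 4 * B₀w * (C₄w * Real.exp (δw * rW)) * (ε₄e + B₀w * bw) < 1)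
    (Ce : GaugeField P j SU2 → WSup (pinW δw (ϖw ∘ pos')) 1 𝔄' → WSup (pinW δw (ϖw ∘ posx)) 1 𝔅) {C₂e RCe : ℝ}
    (hC₂e : 0 ≤ C₂e) (hCqe : ∀ V, ∀ Z : WSup (pinW δw (ϖw ∘ pos')) 1 𝔄', ‖Z‖ < RCe → ‖Ce V Z‖ ≤ C₂e * ‖Z‖ ^ 2)
    (hCde : ∀ V, DifferentiableOn ℂ (Ce V) (ball 0 RCe))
    (hιew : ∀ V, ∀ Y : WSup (pinW δw (ϖw ∘ pos)) 1 𝔄w, ‖kerOpPin (kι V) δw (ϖw ∘ pos) (ϖw ∘ pos') Y‖ ≤ ‖Y‖)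
    (hqe : 9 * C₂e * B₀w * (ε₄e + B₀w * bw) < 1) (hRCe : 3 * (ε₄e + B₀w * bw) ≤ RCe)
    {𝔱 : Type*} (I : Finset 𝔱) {Ef : 𝔱 → (Λw → 𝔄w) → ℂ} {rE : ℝ} {ee : 𝔱 → ℝ} (hrE : 0 < rE)
    (hEd : ∀ i ∈ I, DifferentiableOn ℂ (Ef i) (ball 0 rE))
    (hEb : ∀ i ∈ I, ∀ Z ∈ ball (0 : Λw → 𝔄w) rE, ‖Ef i Z‖ ≤ ee i) (he0 : ∀ i ∈ I, 0 ≤ ee i)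
    (supp : 𝔱 → Finset Λw) (hblind : ∀ i ∈ I, ∀ A₁ A₂ : Λw → 𝔄w, (∀ b' ∈ supp i, A₁ b' = A₂ b') → Ef i A₁ = Ef i A₂)
    (ϖP : 𝔱 → ℝ) (hdepth : ∀ i ∈ I, ∀ b' ∈ supp i, ϖP i ≤ ϖw (pos b'))
    {LK : ℝ} (hLK : 0 ≤ LK) (hK : ∑ i ∈ I, 2 * ee i / rE * Real.exp (-(δw * ϖP i)) ≤ LK)
    (hcoupE : ((ε₄e + B₀w * bw) + B₀w * (4 * C₂e * (ε₄e + B₀w * bw) ^ 2)) ≤ rE / 2)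
    {BE₁ : ℝ} (hElb₁ : ∀ V (y : Fin m₀ → ℝ), ‖y‖ ≤ S → -BE₁ ≤
      (∑ i ∈ I, Ef i (WSup.toPiL (pinW δw (ϖw ∘ pos)) 1 (landauExp (Ce V)
        (kerOpPin (kι V) δw (ϖw ∘ pos) (ϖw ∘ pos')) (kerOpPin (kH V) δw (ϖw ∘ posx) (ϖw ∘ pos))
        (4 * C₂e * (ε₄e + B₀w * bw) ^ 2)
        (solAt (kerOpPin (k𝒢 V) δw (ϖw ∘ posz) (ϖw ∘ pos)) 0
          (fun Y : WSup (pinW δw (ϖw ∘ pos)) 1 𝔄w =>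
            ((toPiL (pinW δw (ϖw ∘ posz)) 1).symm (W𝒱w V (toPiL (pinW δw (ϖw ∘ pos)) 1 Y)) : WSup (pinW δw (ϖw ∘ posz)) 1 ℭ))
          ε₄e (0 : WSup (pinW δw (ϖw ∘ posz)) 1 ℭ)
          (kerOpPin (kH₁ V) δw (ϖw ∘ posb) (ϖw ∘ pos) ((toPiL (pinW δw (ϖw ∘ posb)) 1).symm (Φw V (cplx y)))) +
            kerOpPin (kH₁ V) δw (ϖw ∘ posb) (ϖw ∘ pos) ((toPiL (pinW δw (ϖw ∘ posb)) 1).symm (Φw V (cplx y))))))).re)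
    -- ══ (S78) THE FLUCTUATION-DRESSED TERMS: `−log ∫ g e^{A} dμ` with an ω-UNIFORM ray constant `B_d`, integrability and
    -- positivity of the dressed integral, a lower bound on the S-ball (all DISPLAYED) ══
    {Ω : Type*} [MeasurableSpace Ω] (μ : Measure Ω) {g : Ω → ℝ} (hg : ∀ ω, 0 ≤ g ω)
    (A : GaugeField P j SU2 → (Fin m₀ → ℝ) → Ω → ℝ) {Bd : ℝ} (hBd0 : 0 ≤ Bd)
    (hint : ∀ V, ∀ x ∈ W V, ∀ c : ℝ, 1 / 2 ≤ c → c ≤ 1 → Integrable (fun ω => g ω * Real.exp (A V (c • x) ω)) μ)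
    (hpos : ∀ V, ∀ x ∈ W V, ∀ c : ℝ, 1 / 2 ≤ c → c ≤ 1 → 0 < ∫ ω, g ω * Real.exp (A V (c • x) ω) ∂μ)
    (hA : ∀ V, ∀ x ∈ W V, ∀ c : ℝ, 1 / 2 ≤ c → c ≤ 1 → ∀ ω, A V x ω ≤ A V (c • x) ω + (1 - c) * Bd)
    {BE₂ : ℝ} (hElb₂ : ∀ V (y : Fin m₀ → ℝ), ‖y‖ ≤ S → -BE₂ ≤ (-Real.log (∫ ω, g ω * Real.exp (A V y ω) ∂μ)))
    (L : Set (𝒴 →L[ℂ] Matrix n n ℂ))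
    (𝓡𝒵 : AddSubgroup 𝒵) (𝓡𝒴' : AddSubgroup 𝒴') (𝓡𝒳 : AddSubgroup 𝒳) (h𝓡𝒳 : IsClosed (𝓡𝒳 : Set 𝒳))
    (𝓡ℬ : AddSubgroup ℬ)
    (h𝒢r : ∀ V, ∀ f ∈ 𝓡𝒵, 𝒢 V f ∈ readOutReal L) (hWr : ∀ V, ∀ Y ∈ readOutReal L, W𝒱 V Y ∈ 𝓡𝒵)
    (hιr : ∀ V, ∀ Y ∈ readOutReal L, ιs V Y ∈ 𝓡𝒴') (hHr : ∀ V, ∀ X ∈ 𝓡𝒳, Hop V X ∈ readOutReal L)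
    (hCr : ∀ V, ∀ Z ∈ 𝓡𝒴', Cf V Z ∈ 𝓡𝒳) (hH₁r : ∀ V, ∀ B ∈ 𝓡ℬ, H₁ V B ∈ readOutReal L)
    (hΦr : ∀ V, ∀ y : Fin m₀ → ℝ, ‖y‖ ≤ S → Φ V (cplx y) ∈ 𝓡ℬ)
    (hRdict : ∀ V, ∀ x ∈ cube m₀ S,
      F (fixTo T U₀ (updateFinset V Λ (expFibreChart Λ (c V) e x))) =
        Jco V x * ENNReal.ofReal (Real.exp (-((∑ p ∈ Pw, β * (1 - (Matrix.trace (Bp V p * holOf (ℓw p)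
            (fun y => landauExp (Cw V) (kerOp (kι V)) (kerOp (kH V)) (4 * C₂w * (ε₄w + B₀w * bw) ^ 2)
              (solAt (kerOp (k𝒢 V)) 0 (W𝒱w V) ε₄w (0 : Λz → ℭ) (kerOp (kH₁ V) (Φw V (cplx y))) +
                kerOp (kH₁ V) (Φw V (cplx y)))) x)).re /
            Fintype.card n)) +
          ((∑ i ∈ I, Ef i (WSup.toPiL (pinW δw (ϖw ∘ pos)) 1 (landauExp (Ce V)
        (kerOpPin (kι V) δw (ϖw ∘ pos) (ϖw ∘ pos')) (kerOpPin (kH V) δw (ϖw ∘ posx) (ϖw ∘ pos))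
        (4 * C₂e * (ε₄e + B₀w * bw) ^ 2)
        (solAt (kerOpPin (k𝒢 V) δw (ϖw ∘ posz) (ϖw ∘ pos)) 0
          (fun Y : WSup (pinW δw (ϖw ∘ pos)) 1 𝔄w =>
            ((toPiL (pinW δw (ϖw ∘ posz)) 1).symm (W𝒱w V (toPiL (pinW δw (ϖw ∘ pos)) 1 Y)) : WSup (pinW δw (ϖw ∘ posz)) 1 ℭ))
          ε₄e (0 : WSup (pinW δw (ϖw ∘ posz)) 1 ℭ)
          (kerOpPin (kH₁ V) δw (ϖw ∘ posb) (ϖw ∘ pos) ((toPiL (pinW δw (ϖw ∘ posb)) 1).symm (Φw V (cplx x)))) +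
            kerOpPin (kH₁ V) δw (ϖw ∘ posb) (ϖw ∘ pos) ((toPiL (pinW δw (ϖw ∘ posb)) 1).symm (Φw V (cplx x))))))).re +
          (-Real.log (∫ ω, g ω * Real.exp (A V x ω) ∂μ)))))))
    (hudict : ∀ V, ∀ x ∈ cube m₀ S,
      u (fixTo T U₀ (updateFinset V Λ (expFibreChart Λ (c V) e x))) =
        classifier hPu (fun p => holOf (ℓs p) (fun y => landauExp (Cf V) (ιs V) (Hop V)
          (4 * C₂ * (ε₄ + B₀ * (2 * dL * C₁ * ε₁)) ^ 2)
          (solAt (𝒢 V) 0 (W𝒱 V) ε₄ (0 : 𝒵) (H₁ V (Φ V (cplx y))) + H₁ V (Φ V (cplx y))))) x)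
    (hJW : ∀ V x, Jco V x ≠ 0 → x ∈ W V)
    (hJ : ∀ V x, ∀ a : ℝ, 0 ≤ a → Jco V x ≤ Jco V (Real.exp (-a) • x))
    (hJ1 : ∀ V x, Jco V x ≤ 1)
    (hWS : ∀ V, W V ⊆ closedBall (0 : Fin m₀ → ℝ) S)
    (hδ0 : 0 ≤ δ) (hδ1 : δ < 1) (hρ0 : 0 ≤ ρ) (hρ : ρ ≤ (1 - δ) / 2) (hβ : 0 ≤ β)
    -- SM-L2 (SM) DISCHARGED IN THE STOKES CURRENCY (S73 `hSM_of_stokes`): the η-scalings of the classifier's read-out data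
    -- DISPLAYED — curl read-out × field size `κ_c·z̄ ≤ c₁η²z` (B11 (25)∕(37) TYPE), letter size `κ_r·z̄ ≤ c₂ηz` ((19) TYPE),
    -- regime `m·κ_r·z̄ ≤ 1` — the UNIT-currency smallness `36(c₁z + m²c₂²z²)∕(r_Φ∕S − 1)² ≤ δ·εθ`, and the classifier
    -- threshold `θ := εθ·η²` (B14 (2.17) TYPE): the `η²` CANCELS
    {η εθ c₁ c₂ z : ℝ} (hη : 0 < η) (hεθ : 0 < εθ)
    (hs₁ : κc * ((ε₄ + B₀ * (2 * dL * C₁ * ε₁)) + B₀ * (4 * C₂ * (ε₄ + B₀ * (2 * dL * C₁ * ε₁)) ^ 2)) ≤ c₁ * η ^ 2 * z)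
    (ha : κr * ((ε₄ + B₀ * (2 * dL * C₁ * ε₁)) + B₀ * (4 * C₂ * (ε₄ + B₀ * (2 * dL * C₁ * ε₁)) ^ 2)) ≤ c₂ * η * z)
    (hma : m * (κr * ((ε₄ + B₀ * (2 * dL * C₁ * ε₁)) + B₀ * (4 * C₂ * (ε₄ + B₀ * (2 * dL * C₁ * ε₁)) ^ 2))) ≤ 1)
    (hsm : 36 * (c₁ * z + m ^ 2 * c₂ ^ 2 * z ^ 2) / (rΦ / S - 1) ^ 2 ≤ δ * εθ) :
    SlotAntiConcentration ((fieldMeasure P j SU2).withDensity F) u (εθ * η ^ 2) ρ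
      (2 * ((m₀ : ℝ) + (3 * (|β| * ((dbar +
          2 * (κcb * (cH₁ * MH₁ * bw / ((1 - c𝒢 * M𝒢 * (4 * C₄w * (ε₄w + B₀w * bw) * Real.exp (δw * rW))) *
              (1 - 12 * C₂w * (ε₄w + B₀w * bw) * Real.exp (δw * rC) * (cι * Mι) * (cH * MH)))) +
            expTail₂ (mw * (κwb * (cH₁ * MH₁ * bw / ((1 - c𝒢 * M𝒢 * (4 * C₄w * (ε₄w + B₀w * bw) * Real.exp (δw * rW))) *
              (1 - 12 * C₂w * (ε₄w + B₀w * bw) * Real.exp (δw * rC) * (cι * Mι) * (cH * MH))))))) / (rΦw / S)) *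
          (2 * (κcb * (cH₁ * MH₁ * bw / ((1 - c𝒢 * M𝒢 * (4 * C₄w * (ε₄w + B₀w * bw) * Real.exp (δw * rW))) *
              (1 - 12 * C₂w * (ε₄w + B₀w * bw) * Real.exp (δw * rC) * (cι * Mι) * (cH * MH)))) +
            expTail₂ (mw * (κwb * (cH₁ * MH₁ * bw / ((1 - c𝒢 * M𝒢 * (4 * C₄w * (ε₄w + B₀w * bw) * Real.exp (δw * rW))) *
              (1 - 12 * C₂w * (ε₄w + B₀w * bw) * Real.exp (δw * rC) * (cι * Mι) * (cH * MH))))))) / (rΦw / S))) * Kw) +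
        (3 * (LK * (2 * ((ε₄e + B₀w * bw) + B₀w * (4 * C₂e * (ε₄e + B₀w * bw) ^ 2)))) / (rΦw / S - 1) + Bd))) / (1 - δ)) := by
  have hSrw : S < rΦw := by linarith
  have hRade : 1 < rΦw / S := by rw [lt_div_iff₀ hS]; linarith
  -- sizes for the located second-order Wilson constant and for the profile's nonnegativity
  have hbw : 0 ≤ bw := (norm_nonneg _).trans (hΦbw U₀ 0 (mem_ball_self (by linarith))).le
  have hzE : 0 ≤ ((ε₄e + B₀w * bw) + B₀w * (4 * C₂e * (ε₄e + B₀w * bw) ^ 2)) := by positivity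
  have hεw : 0 ≤ ε₄w + B₀w * bw := add_nonneg hε₄w (mul_nonneg hB₀w.le hbw)
  have hRCw3 : 3 * (ε₄w + B₀w * bw) ≤ RCw := by linarith
  have hBW : 0 ≤ 3 * (|β| * ((dbar +
          2 * (κcb * (cH₁ * MH₁ * bw / ((1 - c𝒢 * M𝒢 * (4 * C₄w * (ε₄w + B₀w * bw) * Real.exp (δw * rW))) *
              (1 - 12 * C₂w * (ε₄w + B₀w * bw) * Real.exp (δw * rC) * (cι * Mι) * (cH * MH)))) +
            expTail₂ (mw * (κwb * (cH₁ * MH₁ * bw / ((1 - c𝒢 * M𝒢 * (4 * C₄w * (ε₄w + B₀w * bw) * Real.exp (δw * rW))) *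
              (1 - 12 * C₂w * (ε₄w + B₀w * bw) * Real.exp (δw * rC) * (cι * Mι) * (cH * MH))))))) / (rΦw / S)) *
          (2 * (κcb * (cH₁ * MH₁ * bw / ((1 - c𝒢 * M𝒢 * (4 * C₄w * (ε₄w + B₀w * bw) * Real.exp (δw * rW))) *
              (1 - 12 * C₂w * (ε₄w + B₀w * bw) * Real.exp (δw * rC) * (cι * Mι) * (cH * MH)))) +
            expTail₂ (mw * (κwb * (cH₁ * MH₁ * bw / ((1 - c𝒢 * M𝒢 * (4 * C₄w * (ε₄w + B₀w * bw) * Real.exp (δw * rW))) *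
              (1 - 12 * C₂w * (ε₄w + B₀w * bw) * Real.exp (δw * rC) * (cι * Mι) * (cH * MH))))))) / (rΦw / S))) * Kw) := by
    have hKw0 : 0 ≤ Kw := (Finset.sum_nonneg fun _ _ => Real.exp_nonneg _).trans hKw
    have hk1 : 0 < 1 - 12 * C₂w * (ε₄w + B₀w * bw) * Real.exp (δw * rC) * (cι * Mι) * (cH * MH) := by linarith
    have hs1 : 0 < 1 - c𝒢 * M𝒢 * (4 * C₄w * (ε₄w + B₀w * bw) * Real.exp (δw * rW)) := by linarith
    have hz : 0 ≤ (cH₁ * MH₁ * bw / ((1 - c𝒢 * M𝒢 * (4 * C₄w * (ε₄w + B₀w * bw) * Real.exp (δw * rW))) *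
              (1 - 12 * C₂w * (ε₄w + B₀w * bw) * Real.exp (δw * rC) * (cι * Mι) * (cH * MH)))) :=
      div_nonneg (mul_nonneg (mul_nonneg hcH₁ hMH₁) hbw) (mul_pos hs1 hk1).le
    have hSbar : 0 ≤ (κcb * (cH₁ * MH₁ * bw / ((1 - c𝒢 * M𝒢 * (4 * C₄w * (ε₄w + B₀w * bw) * Real.exp (δw * rW))) *
          (1 - 12 * C₂w * (ε₄w + B₀w * bw) * Real.exp (δw * rC) * (cι * Mι) * (cH * MH)))) +
        expTail₂ (mw * (κwb * (cH₁ * MH₁ * bw / ((1 - c𝒢 * M𝒢 * (4 * C₄w * (ε₄w + B₀w * bw) * Real.exp (δw * rW))) *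
          (1 - 12 * C₂w * (ε₄w + B₀w * bw) * Real.exp (δw * rC) * (cι * Mι) * (cH * MH))))))) :=
      add_nonneg (mul_nonneg hκcb hz) (T4ShellMeasurePlaquette.expTail₂_nonneg _)
    have hRad : 0 < rΦw / S := div_pos (by linarith) hS
    have h2S' : 0 ≤ 2 * (κcb * (cH₁ * MH₁ * bw / ((1 - c𝒢 * M𝒢 * (4 * C₄w * (ε₄w + B₀w * bw) * Real.exp (δw * rW))) *
              (1 - 12 * C₂w * (ε₄w + B₀w * bw) * Real.exp (δw * rC) * (cι * Mι) * (cH * MH)))) +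
            expTail₂ (mw * (κwb * (cH₁ * MH₁ * bw / ((1 - c𝒢 * M𝒢 * (4 * C₄w * (ε₄w + B₀w * bw) * Real.exp (δw * rW))) *
              (1 - 12 * C₂w * (ε₄w + B₀w * bw) * Real.exp (δw * rC) * (cι * Mι) * (cH * MH))))))) / (rΦw / S) :=
      div_nonneg (mul_nonneg zero_le_two hSbar) hRad.le
    exact mul_nonneg (by norm_num) (mul_nonneg (mul_nonneg (abs_nonneg β)
      (mul_nonneg (add_nonneg hdbar h2S') h2S')) hKw0)
  have hBE : 0 ≤ 3 * (LK * (2 * ((ε₄e + B₀w * bw) + B₀w * (4 * C₂e * (ε₄e + B₀w * bw) ^ 2)))) / (rΦw / S - 1) + Bd :=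
    add_nonneg (div_nonneg (by positivity) (by linarith)) hBd0
  refine slotAC_realized_su2_landauChart_final hT U₀ Λ e hS hSπ c hF hFi hFsupp hu hui hPu W Jco 𝒢 W𝒱 h𝒢 hW hB₀
    hC₄ hε₄ hdL hC₁ hε₁ hB₃ h1 h2 h3 H₁ hH₁ Φ hΦd hΦ0 hΦ hSr Cf hC₂ hCq hCd ιs hι Hop hH h18 hcoup h3R ℓs hκ hℓ hlen
    hκc hcurl
    (fun V y => ∑ p ∈ Pw, β * (1 - (Matrix.trace (Bp V p * holOf (ℓw p)
      (fun y => landauExp (Cw V) (kerOp (kι V)) (kerOp (kH V)) (4 * C₂w * (ε₄w + B₀w * bw) ^ 2)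
        (solAt (kerOp (k𝒢 V)) 0 (W𝒱w V) ε₄w (0 : Λz → ℭ) (kerOp (kH₁ V) (Φw V (cplx y))) +
          kerOp (kH₁ V) (Φw V (cplx y)))) y)).re /
          Fintype.card n))
    (fun V y => (∑ i ∈ I, Ef i (WSup.toPiL (pinW δw (ϖw ∘ pos)) 1 (landauExp (Ce V)
        (kerOpPin (kι V) δw (ϖw ∘ pos) (ϖw ∘ pos')) (kerOpPin (kH V) δw (ϖw ∘ posx) (ϖw ∘ pos))
        (4 * C₂e * (ε₄e + B₀w * bw) ^ 2)
        (solAt (kerOpPin (k𝒢 V) δw (ϖw ∘ posz) (ϖw ∘ pos)) 0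
          (fun Y : WSup (pinW δw (ϖw ∘ pos)) 1 𝔄w =>
            ((toPiL (pinW δw (ϖw ∘ posz)) 1).symm (W𝒱w V (toPiL (pinW δw (ϖw ∘ pos)) 1 Y)) : WSup (pinW δw (ϖw ∘ posz)) 1 ℭ))
          ε₄e (0 : WSup (pinW δw (ϖw ∘ posz)) 1 ℭ)
          (kerOpPin (kH₁ V) δw (ϖw ∘ posb) (ϖw ∘ pos) ((toPiL (pinW δw (ϖw ∘ posb)) 1).symm (Φw V (cplx y)))) +
            kerOpPin (kH₁ V) δw (ϖw ∘ posb) (ϖw ∘ pos) ((toPiL (pinW δw (ϖw ∘ posb)) 1).symm (Φw V (cplx y))))))).re +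
      (-Real.log (∫ ω, g ω * Real.exp (A V y ω) ∂μ)))
    (BElb := BE₁ + BE₂)
    (fun V x hx c' hc hc1 => ?_) hBW (fun V x hx c' hc hc1 => ?_) hBE (fun V y hy => ?_) (fun V y hy => ?_)
    L 𝓡𝒵 𝓡𝒴' 𝓡𝒳 h𝓡𝒳 𝓡ℬ h𝒢r hWr hιr hHr hCr hH₁r hΦr (fun V x hx => by simpa only using hRdict V x hx) hudict hJW hJ
    hJ1 hWS hδ0 hδ1 hρ0 hρ hβ hη hεθ hs₁ ha hma hsm
  · -- the WILSON slot AT THE READING OF RECORD, TWO RADII, LOCATED: file 4 `…_located_schwarz_of_decay` per exterior section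
    exact hE_landau_wilsonSquares_located_schwarz_of_decay_field hS (hWS V) hδw ϖw dis hϖw pos posz pos' posx posb (k𝒢 V) (kι V)
      (kH V) (kH₁ V) hc𝒢 hM𝒢 (hk𝒢 V) hM𝒢' hcι hMι (hkι V) hMι' hcH hMH (hkH V) hMH' hcH₁ hMH₁ (hkH₁ V) hMH₁' (h𝒢w V)
      (hWw V) hB₀w hC₄w hε₄w hdomw hselfw hcontrw (hH₁w V) (hΦdw V) (hΦ0w V) (hΦbw V) h2Sw hC₂w (hCqw V) (hCdw V)
      (hιw V) (hHw V) hqw hRCw NW (hlocW V) hreachW NC (hlocC V) hreachC (hsupp V) hqW hk ℓw suppw ϖPw hblindw hdepthw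
      hϖPw hκwb hκcb hℓwb hcurlw hlenw 𝓡𝒴w h𝓡𝒴w 𝓡𝒵w 𝓡𝒴w' 𝓡𝒳w h𝓡𝒳w 𝓡ℬw (h𝒢rw V) (hWrw V) (hιrw V) (hHrw V)
      (hCrw V) (hH₁rw V) (hΦrw V) hskew (Bp V) (hBu V) (hBd V) hd hdbar hKw β x hx c' hc hc1
  · -- the NON-WILSON slot: S71 f2 located terms ⊕ S78 dressed terms (`rayBound_add`)
    have h1 := hE_landau_chartRay_pinned_w hδw ϖw hϖ0 dis hϖw pos posz pos' posx posb hS (hWS V) (k𝒢 V) (kH₁ V) (kH V)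
      hc𝒢 hM𝒢 (hk𝒢 V) hM𝒢' hcH hMH (hkH V) hMH' hcH₁ hMH₁ (hkH₁ V) hMH₁' hB𝒢w hBH₁w hBHw hB₀w (W𝒱w V) (hWw V) hC₄w NW
      (hlocW V) hreachW (hΦdw V) (hΦ0w V) (hΦbw V) hSrw (hsupp V) hε₄e hdome hselfe hcontre hC₂e (hCqe V) (hCde V) (kι V)
      (hιew V) hqe hRCe I hrE hEd hEb he0 supp hblind ϖP hdepth hK hcoupE x hx c' hc hc1
    have h2 := rayBound_of_logIntegral μ hg (A V) (hint V) (hpos V) (hA V) x hx c' hc hc1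
    simp only at h1 h2 ⊢
    linarith
  · -- the Wilson profile is nonnegative at real chart points (S80 §1b BY NAME)
    exact wilsonProfile_nonneg Pw (h𝒢w V) (hWw V) hB₀w hC₄w hε₄w hdomw hselfw hcontrw (kerOp (kH₁ V)) (hH₁w V)
      (hΦbw V) hSrw hC₂w (hCqw V) (hCdw V) (kerOp (kι V)) (hιw V) (kerOp (kH V)) (hHw V) hqw hRCw3 ℓw 𝓡𝒴w h𝓡𝒴w 𝓡𝒵w
      𝓡𝒴w' 𝓡𝒳w h𝓡𝒳w 𝓡ℬw (h𝒢rw V) (hWrw V) (hιrw V) (hHrw V) (hCrw V) (hH₁rw V) (hΦrw V) hskew (Bp V) (hBu V) hβ hy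
  · -- the lower bound of the non-Wilson part
    have h1 := hElb₁ V y hy
    have h2 := hElb₂ V y hy
    linarith

end Assembled

end Summit.QuantumFields.BalabanUV.T4Continuum.ShellMeasureLandauEndRayStokesAssembledDecayV6

end
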